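import Summits.Ventures.CertifiedArithmetic.LowPrec.Successor
import Summits.Ventures.CertifiedArithmetic.LowPrec.DirectedEFT
import Summits.Ventures.CertifiedArithmetic.LowPrec.EnvelopeStructural
import Summits.Ventures.CertifiedArithmetic.LowPrec.SRSpacing

/-!
# Conversion envelopes: the sharp relative-error constants of narrowing conversions

HONEST FRAMING (venture CertifiedArithmetic / cell `pub-lowprec`): certified error envelopes and
provably optimal rounding/accumulation schemes for low-precision formats under stated cost models;
every table by two implementations; no hardware or vendor claims.

The cell's conversion tables (`ENVELOPES.md` §5: every code of a wide source `ψ` converted to a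
narrow destination `φ`, four rounding modes, two implementations) report a "rel(normal)" column:
the largest relative error over sources in the normal range of `φ`. This file PROVES those
constants from the format parameters, for every pair with `m_φ ≤ m_ψ` and `bias_φ ≤ bias_ψ`
(`u = 2^-(m+1)` the unit roundoff; `2u_φ = 2^-m_φ`, `2u_ψ = 2^-m_ψ`):
* RNE: `≤ u_φ/(1+u_φ)` (`EnvelopeStructural.lean`, any real input) and ATTAINED by a source value
  (the midpoint above the least normal of `φ` is a `ψ`-value when `m_φ + 1 ≤ m_ψ`):
  `MiniFloat.conv_rne_sharp_attained`;
* RZ (toward zero): `(x - RZ x)/x ≤ (2u_φ - 2u_ψ)/(1 + 2u_φ - 2u_ψ)` (`MiniFloat.conv_rz_rel_le`) —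
  the source grid stops `2u_ψ·2^e` short of the next `φ`-value, so the classical `2u/(1+2u)` is
  never reached; e.g. bfloat16 → `E2M1`: `63/191`, binary16 → `E2M1`: `511/1535`, bfloat16 →
  `E2M3`/`E4M3`: `15/143`, binary16 → `E3M2`: `255/1279` (the certified table values);
* RU on positive / RD on negative sources (away from zero): `(RU x - x)/x ≤ (2u_φ - 2u_ψ)/(1 + 2u_ψ)`
  (`MiniFloat.conv_ru_rel_le`); e.g. bfloat16 → `E2M1`: `21/43`, binary16 → `E3M2`: `51/205`.
Attainment of the directed constants is recorded per named pair by kernel evaluation (witnesses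
`1 + 2u_φ - 2u_ψ`, `1 + 2u_ψ`), incl. the HELD FP8 destinations (bfloat16 → `E4M3`, `E5M2`). Key
step (`MiniFloat.sub_roundTowardZero_le_of_grid`): a `ψ`-value `x` in the `φ`-bracket `[v, v + G)`
is congruent to `v` modulo `g = G·2^-(m_ψ-m_φ)`, so `x - v ≤ G - g` and `x ≠ v → x - v ≥ g`.
-/

namespace Literature.ComputerArithmetic.FloatingPoint

namespace MiniFloat

open Format

variable {φ ψ : Format}

/-- A datum of magnitude at least `2^m` quanta is normal (`expCode ≥ 1`). [folklore] -/
theorem one_le_expCode_of_le {v : MiniFloat φ} (h : 2 ^ φ.manBits ≤ v.scaledMag) : 1 ≤ v.expCode := by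
  by_contra h0
  have h0 : v.expCode = 0 := by omega
  have := v.man_lt
  unfold scaledMag Format.scaled at h
  rw [if_pos h0] at h
  omega

/-- The least positive normal value `2^m · quantum` is a datum (formats with a normal binade).
[folklore] -/
theorem exists_toRat_eq_minNormal (hφ : 1 ≤ φ.emaxCode) :
    ∃ y : MiniFloat φ, y.toRat = 2 ^ φ.manBits * φ.quantum ∧ y.scaledMag = 2 ^ φ.manBits ∧
      y.expCode = 1 := by
  have htop : (1 : ℕ) = φ.emaxCode → 0 ≤ φ.topMan := fun _ => Nat.zero_le _
  refine ⟨⟨false, 1, 0, hφ, Nat.two_pow_pos _, htop⟩, ?_, ?_, rfl⟩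
  · simp [toRat, toInt, scaledMag, Format.scaled]
  · simp [scaledMag, Format.scaled]

/-- GRID ALIGNMENT: for a normal value `v ≥ 0` of `φ` (ulp `G = 2^(expCode v - 1)` quanta) and a
value `x ≥ v` of a format `ψ` with `m_φ ≤ m_ψ`, `bias_φ ≤ bias_ψ`: `x - v` is an integer multiple
of `g = G / 2^(m_ψ - m_φ)`. [folklore] -/
theorem exists_sub_eq_int_mul_grid {j : ℕ} (hj : ψ.manBits = φ.manBits + j) (hb : φ.bias ≤ ψ.bias)
    {v : MiniFloat φ} (hv : 0 ≤ v.toRat) (hvn : 2 ^ φ.manBits ≤ v.scaledMag)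
    {z : MiniFloat ψ} (hvz : v.toRat ≤ z.toRat) :
    ∃ N : ℤ, z.toRat - v.toRat = (N : ℚ) * (2 ^ (v.expCode - 1) * φ.quantum / 2 ^ j) := by
  have hqφ := φ.quantum_pos
  have hqψ := ψ.quantum_pos
  obtain ⟨k, hk⟩ : ∃ k, ψ.bias = φ.bias + k := ⟨ψ.bias - φ.bias, by omega⟩
  have hquant : φ.quantum = 2 ^ (j + k) * ψ.quantum := by
    rw [quantum_eq_pow_mul_quantum (by omega) hb, hj, hk]; congr 2; omega
  set e := v.expCode - 1 with he
  have hz0 : 0 ≤ z.toRat := le_trans hv hvz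
  have hV := toInt_eq_scaledMag_of_nonneg hv
  have hZ := toInt_eq_scaledMag_of_nonneg hz0
  -- 2^e ∣ V, hence 2^(e+k) ∣ V·2^(j+k)
  have dV : 2 ^ e ∣ v.scaledMag := pow_ulpExp_dvd_scaledMag v
  -- Z ≥ V 2^(j+k) ≥ 2^(m_ψ + e + k)
  have he1 : 1 ≤ v.expCode := one_le_expCode_of_le hvn
  have hVlo : 2 ^ (φ.manBits + e) ≤ v.scaledMag := pow_le_scaledMag_of_expCode_pos v he1
  have hZlo : 2 ^ (ψ.manBits + (e + k)) ≤ z.scaledMag := by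
    have h1 : ((v.scaledMag * 2 ^ (j + k) : ℕ) : ℚ) * ψ.quantum ≤ (z.scaledMag : ℚ) * ψ.quantum := by
      have hvv : v.toRat = ((v.scaledMag * 2 ^ (j + k) : ℕ) : ℚ) * ψ.quantum := by
        rw [toRat_eq_toInt_mul, hV, hquant]; push_cast; ring
      have hzv : z.toRat = (z.scaledMag : ℚ) * ψ.quantum := by
        rw [toRat_eq_toInt_mul, hZ]; push_cast; ring
      rw [← hvv, ← hzv]; exact hvz
    have h2 : v.scaledMag * 2 ^ (j + k) ≤ z.scaledMag := by
      exact_mod_cast le_of_mul_le_mul_right h1 hqψ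
    calc 2 ^ (ψ.manBits + (e + k)) = 2 ^ (φ.manBits + e) * 2 ^ (j + k) := by
          rw [hj, ← pow_add]; ring_nf
      _ ≤ v.scaledMag * 2 ^ (j + k) := Nat.mul_le_mul_right _ hVlo
      _ ≤ z.scaledMag := h2
  have dZ : 2 ^ (e + k) ∣ z.scaledMag := pow_dvd_of_representable z.representable_scaledMag hZlo
  obtain ⟨cV, hcV⟩ := dV
  obtain ⟨cZ, hcZ⟩ := dZ
  refine ⟨(cZ : ℤ) - (cV : ℤ) * 2 ^ j, ?_⟩
  rw [toRat_eq_toInt_mul, toRat_eq_toInt_mul, hV, hZ, hcZ, hcV, hquant]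
  push_cast
  field_simp
  ring

/-- THE BRACKET STEP FOR A SOURCE VALUE: `x` a value of `ψ` (`m_φ ≤ m_ψ`, `bias_φ ≤ bias_ψ`) in the
normal range of `φ` (`2^m_φ·quantum_φ ≤ x ≤ maxRat_φ`, `φ` with `emaxCode ≥ 1`); `v = RZ_φ(x)`,
`G = ulp(v)`, `g = G/2^(m_ψ-m_φ)`. Then `v` is normal, `2^m_φ·G ≤ v ≤ x`, `x - v ≤ G - g`, and
`x ≠ v → g ≤ x - v`. [folklore] -/
theorem sub_roundTowardZero_le_of_grid {j : ℕ} (hj : ψ.manBits = φ.manBits + j) (hb : φ.bias ≤ ψ.bias)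
    (hφ : 1 ≤ φ.emaxCode) (z : MiniFloat ψ) (hlo : 2 ^ φ.manBits * φ.quantum ≤ z.toRat)
    (hhi : z.toRat ≤ φ.maxRat) :
    2 ^ φ.manBits * (2 ^ ((roundTowardZero φ z.toRat).expCode - 1) * φ.quantum)
        ≤ (roundTowardZero φ z.toRat).toRat ∧
    (roundTowardZero φ z.toRat).toRat ≤ z.toRat ∧
    z.toRat - (roundTowardZero φ z.toRat).toRat
      ≤ 2 ^ ((roundTowardZero φ z.toRat).expCode - 1) * φ.quantum
        - 2 ^ ((roundTowardZero φ z.toRat).expCode - 1) * φ.quantum / 2 ^ j ∧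
    (z.toRat ≠ (roundTowardZero φ z.toRat).toRat →
      2 ^ ((roundTowardZero φ z.toRat).expCode - 1) * φ.quantum / 2 ^ j
        ≤ z.toRat - (roundTowardZero φ z.toRat).toRat) := by
  have hqφ := φ.quantum_pos
  set x := z.toRat with hx
  set v := roundTowardZero φ x with hv_def
  have hx0 : 0 < x := lt_of_lt_of_le (by positivity) hlo
  -- v ≥ min normal, v ≤ x
  obtain ⟨y0, hy0, hy0mag, -⟩ := exists_toRat_eq_minNormal (φ := φ) hφ
  have hvlo : 2 ^ φ.manBits * φ.quantum ≤ v.toRat := by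
    rw [← hy0]; exact toRat_le_roundTowardZero_of_le y0 (by rw [hy0]; positivity) (by rw [hy0]; exact hlo)
  have hv0 : 0 ≤ v.toRat := le_trans (by positivity) hvlo
  have hvx : v.toRat ≤ x := toRat_roundTowardZero_le_of_nonneg hx0.le
  have hvv : v.toRat = (v.scaledMag : ℚ) * φ.quantum := by
    rw [toRat_eq_toInt_mul, toInt_eq_scaledMag_of_nonneg hv0]; push_cast; ring
  have hvn : 2 ^ φ.manBits ≤ v.scaledMag := by
    have h1 : ((2 ^ φ.manBits : ℕ) : ℚ) * φ.quantum ≤ (v.scaledMag : ℚ) * φ.quantum := by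
      push_cast; rw [← hvv]; exact hvlo
    exact_mod_cast le_of_mul_le_mul_right h1 hqφ
  have he1 : 1 ≤ v.expCode := one_le_expCode_of_le hvn
  set G := 2 ^ (v.expCode - 1) * φ.quantum with hG
  have hG0 : 0 < G := by positivity
  -- v ≥ 2^m G
  have hvG : 2 ^ φ.manBits * G ≤ v.toRat := by
    have h1 := pow_le_scaledMag_of_expCode_pos v he1
    rw [toRat_eq_toInt_mul, toInt_eq_scaledMag_of_nonneg hv0, hG]
    have : ((2 ^ (φ.manBits + (v.expCode - 1)) : ℕ) : ℚ) ≤ (v.scaledMag : ℚ) := by exact_mod_cast h1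
    push_cast at this
    calc (2:ℚ) ^ φ.manBits * (2 ^ (v.expCode - 1) * φ.quantum)
        = 2 ^ (φ.manBits + (v.expCode - 1)) * φ.quantum := by rw [pow_add]; ring
      _ ≤ (v.scaledMag : ℚ) * φ.quantum := mul_le_mul_of_nonneg_right this hqφ.le
  -- x < v + G
  have hxG : x < v.toRat + G := by
    by_contra hge
    push Not at hge
    -- v < top (else x = v) and the successor v + G ≤ x would be ≤ RZ x = v
    rcases eq_or_lt_of_le (le_trans hvx hhi) with hvtop | hvtop
    · -- v = maxRat = x
      have : x = v.toRat := le_antisymm (by rw [hvtop]; exact hhi) hvx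
      rw [this] at hge; linarith
    · have hvt : v.toRat < (top φ).toRat := by rw [toRat_top]; exact hvtop
      obtain ⟨u, hu⟩ := exists_toRat_eq_add_ulp hv0 hvt
      have hux : u.toRat ≤ x := by rw [hu]; exact hge
      have := toRat_le_roundTowardZero_of_le (x := x) u (by rw [hu]; positivity) hux
      rw [hu] at this
      linarith
  -- grid alignment
  obtain ⟨N, hN⟩ := exists_sub_eq_int_mul_grid hj hb hv0 hvn hvx
  have hg0 : 0 < G / 2 ^ j := by positivity
  have hN0 : 0 ≤ N := by
    have : (0 : ℚ) ≤ (N : ℚ) * (G / 2 ^ j) := by rw [← hN]; linarith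
    exact_mod_cast nonneg_of_mul_nonneg_left this hg0
  have hNlt : N < 2 ^ j := by
    have h1 : (N : ℚ) * (G / 2 ^ j) < (2 ^ j : ℚ) * (G / 2 ^ j) := by
      rw [← hN]; field_simp; linarith
    have h2 := lt_of_mul_lt_mul_right h1 hg0.le
    exact_mod_cast h2
  refine ⟨hvG, hvx, ?_, fun hne => ?_⟩
  · -- x - v = N g ≤ (2^j - 1) g = G - g
    have hN1 : (N : ℚ) ≤ (2 ^ j : ℚ) - 1 := by
      have : N ≤ 2 ^ j - 1 := by omega
      exact_mod_cast this
    rw [hN]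
    have : ((2 : ℚ) ^ j - 1) * (G / 2 ^ j) = G - G / 2 ^ j := by field_simp
    rw [← this]
    exact mul_le_mul_of_nonneg_right hN1 hg0.le
  · -- x ≠ v ⇒ N ≥ 1
    have hN1 : (1 : ℚ) ≤ N := by
      have : N ≠ 0 := by
        rintro rfl
        apply hne
        have : x - v.toRat = 0 := by rw [hN]; simp
        linarith
      exact_mod_cast (show (1 : ℤ) ≤ N by omega)
    rw [hN]
    calc G / 2 ^ j = 1 * (G / 2 ^ j) := (one_mul _).symm
      _ ≤ (N : ℚ) * (G / 2 ^ j) := mul_le_mul_of_nonneg_right hN1 hg0.le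

/-- SHARP RZ CONVERSION ENVELOPE: for a source value `x` of `ψ` in the normal range of the
destination `φ` (`m_φ ≤ m_ψ`, `bias_φ ≤ bias_ψ`, `emaxCode_φ ≥ 1`):
`x - RZ_φ(x) ≤ (2u_φ - 2u_ψ)/(1 + 2u_φ - 2u_ψ) · x`, written multiplicatively. [folklore] -/
theorem conv_rz_rel_le (hm : φ.manBits ≤ ψ.manBits) (hb : φ.bias ≤ ψ.bias) (hφ : 1 ≤ φ.emaxCode)
    (z : MiniFloat ψ) (hlo : 2 ^ φ.manBits * φ.quantum ≤ z.toRat) (hhi : z.toRat ≤ φ.maxRat) :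
    (z.toRat - (roundTowardZero φ z.toRat).toRat) * (1 + 2 * φ.unitRoundoff - 2 * ψ.unitRoundoff)
      ≤ (2 * φ.unitRoundoff - 2 * ψ.unitRoundoff) * z.toRat := by
  obtain ⟨j, hj⟩ : ∃ j, ψ.manBits = φ.manBits + j := ⟨ψ.manBits - φ.manBits, by omega⟩
  obtain ⟨hvG, hvx, hd, -⟩ := sub_roundTowardZero_le_of_grid hj hb hφ z hlo hhi
  set x := z.toRat
  set v := (roundTowardZero φ x).toRat
  set G := 2 ^ ((roundTowardZero φ x).expCode - 1) * φ.quantum with hG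
  have hG0 : 0 < G := by have := φ.quantum_pos; positivity
  have h2φ : 2 * φ.unitRoundoff = 1 / 2 ^ φ.manBits := Format.two_mul_unitRoundoff φ
  have h2ψ : 2 * ψ.unitRoundoff = 1 / 2 ^ φ.manBits / 2 ^ j := by
    rw [Format.two_mul_unitRoundoff, hj, pow_add]; field_simp
  rw [h2φ, h2ψ]
  -- reduce to: d (W + G - g) ≤ (G - g) x with W = 2^m G, d = x - v, g = G/2^j
  have hpos : (0:ℚ) < 2 ^ φ.manBits := by positivity
  have hposj : (0:ℚ) < 2 ^ j := by positivity
  have key : (x - v) * (2 ^ φ.manBits * G + G - G / 2 ^ j) ≤ (G - G / 2 ^ j) * x := by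
    have hgG : G / 2 ^ j ≤ G := div_le_self hG0.le (one_le_pow₀ (by norm_num))
    have hW0 : (0:ℚ) ≤ 2 ^ φ.manBits * G := by positivity
    have h1 := mul_nonneg (sub_nonneg.mpr hvG) (sub_nonneg.mpr hgG)
    have h2 := mul_nonneg hW0 (sub_nonneg.mpr hd)
    nlinarith [h1, h2]
  -- divide by 2^m G
  have hscale : (2 ^ φ.manBits * G + G - G / 2 ^ j)
      = (2 ^ φ.manBits * G) * (1 + 1 / 2 ^ φ.manBits - 1 / 2 ^ φ.manBits / 2 ^ j) := by
    field_simp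
  have hscale2 : (G - G / 2 ^ j) = (2 ^ φ.manBits * G) * (1 / 2 ^ φ.manBits - 1 / 2 ^ φ.manBits / 2 ^ j) := by
    field_simp
  rw [hscale, hscale2] at key
  have hW : (0:ℚ) < 2 ^ φ.manBits * G := by positivity
  have key' : (2 ^ φ.manBits * G) * ((x - v) * (1 + 1 / 2 ^ φ.manBits - 1 / 2 ^ φ.manBits / 2 ^ j))
      ≤ (2 ^ φ.manBits * G) * ((1 / 2 ^ φ.manBits - 1 / 2 ^ φ.manBits / 2 ^ j) * x) := by
    nlinarith [key]
  exact le_of_mul_le_mul_left key' hW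

/-- SHARP RU CONVERSION ENVELOPE (away from zero on positive sources): same setting,
`RU_φ(x) - x ≤ (2u_φ - 2u_ψ)/(1 + 2u_ψ) · x`, multiplicatively. [folklore] -/
theorem conv_ru_rel_le (hm : φ.manBits ≤ ψ.manBits) (hb : φ.bias ≤ ψ.bias) (hφ : 1 ≤ φ.emaxCode)
    (z : MiniFloat ψ) (hlo : 2 ^ φ.manBits * φ.quantum ≤ z.toRat) (hhi : z.toRat ≤ φ.maxRat) :
    ((roundUp φ z.toRat).toRat - z.toRat) * (1 + 2 * ψ.unitRoundoff)
      ≤ (2 * φ.unitRoundoff - 2 * ψ.unitRoundoff) * z.toRat := by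
  obtain ⟨j, hj⟩ : ∃ j, ψ.manBits = φ.manBits + j := ⟨ψ.manBits - φ.manBits, by omega⟩
  obtain ⟨hvG, hvx, hd, hgap⟩ := sub_roundTowardZero_le_of_grid hj hb hφ z hlo hhi
  have hqφ := φ.quantum_pos
  set x := z.toRat with hx
  set vd := roundTowardZero φ x with hvd
  set G := 2 ^ (vd.expCode - 1) * φ.quantum with hG
  have hG0 : 0 < G := by positivity
  have hx0 : 0 < x := lt_of_lt_of_le (by positivity) hlo
  have habs : |x| ≤ φ.maxRat := by rw [abs_of_pos hx0]; exact hhi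
  have h2φ : 2 * φ.unitRoundoff = 1 / 2 ^ φ.manBits := Format.two_mul_unitRoundoff φ
  have h2ψ : 2 * ψ.unitRoundoff = 1 / 2 ^ φ.manBits / 2 ^ j := by
    rw [Format.two_mul_unitRoundoff, hj, pow_add]; field_simp
  have hC0 : 0 ≤ (2 * φ.unitRoundoff - 2 * ψ.unitRoundoff) * x := by
    rw [h2φ, h2ψ]
    apply mul_nonneg _ hx0.le
    have : (1:ℚ) / 2 ^ φ.manBits / 2 ^ j ≤ 1 / 2 ^ φ.manBits :=
      div_le_self (by positivity) (one_le_pow₀ (by norm_num))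
    linarith
  by_cases hxv : x = vd.toRat
  · -- x is a φ-value: RU x = x
    have hru : (roundUp φ x).toRat = x := by
      apply le_antisymm
      · have := roundUp_le_toRat habs vd (le_of_eq hxv); rw [← hxv] at this; exact this
      · exact le_toRat_roundUp habs
    rw [hru, sub_self, zero_mul]; exact hC0
  · -- x strictly inside (v, v + G): RU x = v + G
    have hv0 : 0 ≤ vd.toRat := le_trans (by positivity) (le_trans
      (by nlinarith [hG0, (by positivity : (0:ℚ) ≤ 2 ^ φ.manBits)] : (0:ℚ) ≤ 2 ^ φ.manBits * G) hvG)
    have hvlt : vd.toRat < x := lt_of_le_of_ne hvx (Ne.symm hxv)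
    have hvtop : vd.toRat < (top φ).toRat := by rw [toRat_top]; linarith
    obtain ⟨u, hu⟩ := exists_toRat_eq_add_ulp hv0 hvtop
    have hg := hgap hxv
    -- x ≤ v + G - g < v + G = u
    have hxu : x ≤ u.toRat := by
      rw [hu]; change x ≤ vd.toRat + G
      have : G / 2 ^ j > 0 := by positivity
      linarith
    have hru_le : (roundUp φ x).toRat ≤ u.toRat := roundUp_le_toRat habs u hxu
    have hru_ge : u.toRat ≤ (roundUp φ x).toRat := by
      -- RU x is a φ-value > v (as RU x ≥ x > v), hence ≥ v + G
      have h1 : vd.toRat < (roundUp φ x).toRat := lt_of_lt_of_le hvlt (le_toRat_roundUp habs)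
      rw [hu]; exact add_ulp_le_of_lt hv0 h1
    have hru : (roundUp φ x).toRat = vd.toRat + G := by rw [le_antisymm hru_le hru_ge, hu]
    rw [hru, h2φ, h2ψ]
    -- (v + G - x)(1 + g') ≤ (2u_φ - 2u_ψ) x  with d = x - v ≥ g
    have hpos : (0:ℚ) < 2 ^ φ.manBits := by positivity
    have key : (vd.toRat + G - x) * (2 ^ φ.manBits * G + G / 2 ^ j) ≤ (G - G / 2 ^ j) * x := by
      have hgG : G / 2 ^ j ≤ G := div_le_self hG0.le (one_le_pow₀ (by norm_num))
      have hW0 : (0:ℚ) ≤ 2 ^ φ.manBits * G := by positivity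
      have h1 := mul_nonneg (sub_nonneg.mpr hvG) (sub_nonneg.mpr hgG)
      have h2 := mul_nonneg (sub_nonneg.mpr hg) (by positivity : (0:ℚ) ≤ G + 2 ^ φ.manBits * G)
      nlinarith [h1, h2]
    have hscale : (2 ^ φ.manBits * G + G / 2 ^ j)
        = (2 ^ φ.manBits * G) * (1 + 1 / 2 ^ φ.manBits / 2 ^ j) := by field_simp
    have hscale2 : (G - G / 2 ^ j)
        = (2 ^ φ.manBits * G) * (1 / 2 ^ φ.manBits - 1 / 2 ^ φ.manBits / 2 ^ j) := by field_simp
    rw [hscale, hscale2] at key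
    have hW : (0:ℚ) < 2 ^ φ.manBits * G := by positivity
    have key' : (2 ^ φ.manBits * G) * ((vd.toRat + G - x) * (1 + 1 / 2 ^ φ.manBits / 2 ^ j))
        ≤ (2 ^ φ.manBits * G) * ((1 / 2 ^ φ.manBits - 1 / 2 ^ φ.manBits / 2 ^ j) * x) := by
      nlinarith [key]
    exact le_of_mul_le_mul_left key' hW

/-- RNE CONVERSION CONSTANT IS ATTAINED: with `m_φ + 1 ≤ m_ψ`, `bias_φ ≤ bias_ψ`,
`maxRat φ ≤ maxRat ψ` and `emaxCode_φ ≥ 2`, the midpoint `x = (1 + u_φ)·2^m_φ·quantum_φ` above the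
least normal of `φ` is a value of `ψ` with `|x - RN_φ(x)| = u_φ/(1+u_φ)·|x|` (ulp `½`).
[cite: JeannerodRump2018, Thm 2.1] -/
theorem conv_rne_sharp_attained (hm : φ.manBits + 1 ≤ ψ.manBits) (hb : φ.bias ≤ ψ.bias)
    (hmax : φ.maxRat ≤ ψ.maxRat) (hφ : 2 ≤ φ.emaxCode) :
    ∃ z : MiniFloat ψ, 2 ^ φ.manBits * φ.quantum ≤ z.toRat ∧ z.toRat ≤ φ.maxRat ∧
      |z.toRat - (roundNE φ z.toRat).toRat|
        = φ.unitRoundoff / (1 + φ.unitRoundoff) * |z.toRat| := by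
  have hqφ := φ.quantum_pos
  have hφ1 : 1 ≤ φ.emaxCode := by omega
  obtain ⟨v, hv, hvmag, hvE⟩ := exists_toRat_eq_minNormal (φ := φ) hφ1
  have hv0 : 0 ≤ v.toRat := by rw [hv]; positivity
  -- v < top (emaxCode ≥ 2 gives maxScaled ≥ 2^(m+1) > 2^m)
  have hvtop : v.toRat < (top φ).toRat := by
    rw [toRat_top, hv]
    unfold Format.maxRat
    have h1 := Format.pow_le_maxScaled (φ := φ) hφ
    have h2 : ((2 ^ φ.manBits : ℕ) : ℚ) < (φ.maxScaled : ℚ) := by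
      have h3 : 2 ^ φ.manBits < 2 ^ (φ.manBits + 1) := Nat.pow_lt_pow_right (by norm_num) (by omega)
      exact_mod_cast lt_of_lt_of_le h3 h1
    push_cast at h2
    exact mul_lt_mul_of_pos_right h2 hqφ
  obtain ⟨u, hu⟩ := exists_toRat_eq_add_ulp hv0 hvtop
  obtain ⟨z, hz⟩ := exists_toRat_eq_midpoint hm hb hmax hv0 hu
  rw [hvE] at hz hu
  simp only [Nat.sub_self, pow_zero, one_mul] at hz hu
  -- G = quantum, x = v + q/2
  have hgap : ∀ y : MiniFloat φ, y.toRat ≤ v.toRat ∨ v.toRat + φ.quantum ≤ y.toRat := by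
    intro y
    by_cases hy : y.toRat ≤ v.toRat
    · exact Or.inl hy
    · right
      have := add_ulp_le_of_lt hv0 (not_le.mp hy)
      rwa [hvE, Nat.sub_self, pow_zero, one_mul] at this
  set x := z.toRat with hxdef
  refine ⟨z, ?_, ?_, ?_⟩
  · rw [← hxdef, hz, hv]; linarith
  · rw [← hxdef]
    calc x = v.toRat + φ.quantum / 2 := hz
      _ ≤ u.toRat := by rw [hu]; linarith
      _ ≤ φ.maxRat := le_trans (le_abs_self _) (abs_toRat_le_maxRat u)
  · -- |x - RN x| = q/2: ≥ by the gap, ≤ by nearest (v is a candidate)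
    rw [← hxdef]
    have hle : |x - (roundNE φ x).toRat| ≤ φ.quantum / 2 := by
      have h := roundNE_nearest (φ := φ) x v
      rwa [show x - v.toRat = φ.quantum / 2 by rw [hz]; ring, abs_of_pos (half_pos hqφ)] at h
    have hge : φ.quantum / 2 ≤ |x - (roundNE φ x).toRat| := by
      rcases hgap (roundNE φ x) with h | h
      · rw [abs_of_nonneg (by linarith)]; linarith
      · rw [abs_of_nonpos (by linarith)]; linarith
    have heq : |x - (roundNE φ x).toRat| = φ.quantum / 2 := le_antisymm hle hge
    have hx0 : 0 < x := by rw [hz]; linarith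
    rw [heq, abs_of_pos hx0, hz, hv, Format.unitRoundoff_eq]
    field_simp
    ring

/-! ### Named pairs: the certified and the held conversion constants -/

/-- bfloat16 → `E2M1`: RZ `63/191` at `191/128`, RU `21/43 = 63/129` at `129/128`, RNE `1/5` at
`5/4` (ENVELOPES.md §5 rel(normal) cells). [folklore] -/
theorem conv_BFloat16_E2M1_witnesses :
    let x : MiniFloat BFloat16 := ⟨false, 127, 63, by decide, by decide, by decide⟩
    let y : MiniFloat BFloat16 := ⟨false, 127, 1, by decide, by decide, by decide⟩
    let t : MiniFloat BFloat16 := ⟨false, 127, 32, by decide, by decide, by decide⟩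
    x.toRat = 191 / 128 ∧ (x.toRat - (roundTowardZero E2M1 x.toRat).toRat) / x.toRat = 63 / 191 ∧
    y.toRat = 129 / 128 ∧ ((roundUp E2M1 y.toRat).toRat - y.toRat) / y.toRat = 21 / 43 ∧
    t.toRat = 5 / 4 ∧ |t.toRat - (roundNE E2M1 t.toRat).toRat| / t.toRat = 1 / 5 := by
  decide +kernel

/-- HELD FP8 destinations (constants proved before any table): bfloat16 → `E4M3`: RZ `15/143` at
`143/128`, RU `15/129` at `129/128`, RNE `1/17` at `17/16`; bfloat16 → `E5M2`: RZ `31/159`,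
RU `31/129`, RNE `1/9`. [folklore] -/
theorem conv_BFloat16_FP8_witnesses :
    let x : MiniFloat BFloat16 := ⟨false, 127, 15, by decide, by decide, by decide⟩
    let y : MiniFloat BFloat16 := ⟨false, 127, 1, by decide, by decide, by decide⟩
    let t : MiniFloat BFloat16 := ⟨false, 127, 8, by decide, by decide, by decide⟩
    let x' : MiniFloat BFloat16 := ⟨false, 127, 31, by decide, by decide, by decide⟩
    let t' : MiniFloat BFloat16 := ⟨false, 127, 16, by decide, by decide, by decide⟩
    (x.toRat - (roundTowardZero E4M3 x.toRat).toRat) / x.toRat = 15 / 143 ∧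
    ((roundUp E4M3 y.toRat).toRat - y.toRat) / y.toRat = 15 / 129 ∧
    |t.toRat - (roundNE E4M3 t.toRat).toRat| / t.toRat = 1 / 17 ∧
    (x'.toRat - (roundTowardZero E5M2 x'.toRat).toRat) / x'.toRat = 31 / 159 ∧
    ((roundUp E5M2 y.toRat).toRat - y.toRat) / y.toRat = 31 / 129 ∧
    |t'.toRat - (roundNE E5M2 t'.toRat).toRat| / t'.toRat = 1 / 9 := by
  decide +kernel

end MiniFloat

end Literature.ComputerArithmetic.FloatingPoint
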